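import Mathlib
import Summits.Ventures.PercRepro2.OneEdge
import Summits.Ventures.PercRepro2.TypedMarkedSeriesDefs
import Summits.Ventures.PercRepro2.TypedMarkedSeriesGraph
import Summits.Ventures.PercRepro2.TypedMarkedSeriesStateCD
import Summits.Ventures.PercRepro2.TypedCoincRootEdge

/-!
# The state lemma of the marked star `o ~ {a₁, a₂, b}` (blind cell PercRepro2, night-3 g14,
2026-08-27; `proofs/NIGHT3-CERT.md` §23.10)

`st_modelS`: when `o` carries exactly the edges `e = {a₁, o}` (bit `p`), `f = {o, a₂}` (bit `a`) and
`g = {o, b}` (bit `u`), the state of `x[e ↦ p][f ↦ a][g ↦ u]` is an explicit Boolean function of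
the signature of `x` (all three closed): with `g` closed it is `modelC` (`st_modelC`); opening `g`
joins the cluster of `o` with that of `b` (`conn_update_true_iff`), which rewrites the seven
coordinates through the coordinates of `modelC` and the two further connections `b ~ a₃`, `o ~ a₃`
after `e, f` (`conn_off_mid`, `conn_mid_iff`).  Nothing here asserts anything about the original
lane.
-/

namespace Summit.Ventures.PercRepro2

open UnionCluster

namespace CovForm

namespace MarkedSeries

open OneTyped TypedA3 Untouched TypedRed

section StateLemma

open Classical

variable {V : Type*} {E : Type*} [DecidableEq E]
variable (ends : E → Sym2 V) (o a₁ a₂ a₃ b : V)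

/-- **State lemma S**: `o` with exactly the edges `e = {a₁, o}`, `f = {o, a₂}`, `g = {o, b}`. -/
lemma st_modelS {e f g : E} (hef : e ≠ f) (heg : e ≠ g) (hfg : f ≠ g) (he : ends e = s(a₁, o))
    (hf : ends f = s(o, a₂)) (hg : ends g = s(o, b)) (ho1 : o ≠ a₁) (ho2 : o ≠ a₂) (ho3 : o ≠ a₃)
    (hob : o ≠ b) (x : Config E) (hxe : x e = false) (hxf : x f = false) (hxg : x g = false)
    (hother : ∀ e', e' ≠ e → e' ≠ f → e' ≠ g → o ∈ ends e' → x e' = false) (p a u : Bool) :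
    st ends o a₁ a₂ a₃ b (Function.update (Function.update (Function.update x e p) f a) g u) =
      (if u then ((modelC (decide (Conn ends x a₁ a₂)) (decide (Conn ends x a₁ b)) (decide (Conn ends x a₁ a₃)) (decide (Conn ends x a₂ b)) (decide (Conn ends x a₂ a₃)) (decide (Conn ends x b a₃)) p a).q' || ((modelC (decide (Conn ends x a₁ a₂)) (decide (Conn ends x a₁ b)) (decide (Conn ends x a₁ a₃)) (decide (Conn ends x a₂ b)) (decide (Conn ends x a₂ a₃)) (decide (Conn ends x b a₃)) p a).Ho && (modelC (decide (Conn ends x a₁ a₂)) (decide (Conn ends x a₁ b)) (decide (Conn ends x a₁ a₃)) (decide (Conn ends x a₂ b)) (decide (Conn ends x a₂ a₃)) (decide (Conn ends x b a₃)) p a).Lb) || ((modelC (decide (Conn ends x a₁ a₂)) (decide (Conn ends x a₁ b)) (decide (Conn ends x a₁ a₃)) (decide (Conn ends x a₂ b)) (decide (Conn ends x a₂ a₃)) (decide (Conn ends x b a₃)) p a).Hb && (modelC (decide (Conn ends x a₁ a₂)) (decide (Conn ends x a₁ b)) (decide (Conn ends x a₁ a₃)) (decide (Conn ends x a₂ b))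 (decide (Conn ends x a₂ a₃)) (decide (Conn ends x b a₃)) p a).Lo), (modelC (decide (Conn ends x a₁ a₂)) (decide (Conn ends x a₁ b)) (decide (Conn ends x a₁ a₃)) (decide (Conn ends x a₂ b)) (decide (Conn ends x a₂ a₃)) (decide (Conn ends x b a₃)) p a).Lo || (modelC (decide (Conn ends x a₁ a₂)) (decide (Conn ends x a₁ b)) (decide (Conn ends x a₁ a₃)) (decide (Conn ends x a₂ b)) (decide (Conn ends x a₂ a₃)) (decide (Conn ends x b a₃)) p a).Lb, (modelC (decide (Conn ends x a₁ a₂)) (decide (Conn ends x a₁ b)) (decide (Conn ends x a₁ a₃)) (decide (Conn ends x a₂ b)) (decide (Conn ends x a₂ a₃)) (decide (Conn ends x b a₃)) p a).Ho || (modelC (decide (Conn ends x a₁ a₂)) (decide (Conn ends x a₁ b)) (decide (Conn ends x a₁ a₃)) (decide (Conn ends x a₂ b)) (decide (Conn ends x a₂ a₃)) (decide (Conn ends x b a₃)) p a).Hb, (modelC (decide (Conn ends x a₁ a₂)) (decide (Conn ends x a₁ b)) (decide (Conn ends x a₁ a₃)) (decide (Conn ends x a₂ b)) (decide (Conn ends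 x a₂ a₃)) (decide (Conn ends x b a₃)) p a).Lb || (modelC (decide (Conn ends x a₁ a₂)) (decide (Conn ends x a₁ b)) (decide (Conn ends x a₁ a₃)) (decide (Conn ends x a₂ b)) (decide (Conn ends x a₂ a₃)) (decide (Conn ends x b a₃)) p a).Lo, (modelC (decide (Conn ends x a₁ a₂)) (decide (Conn ends x a₁ b)) (decide (Conn ends x a₁ a₃)) (decide (Conn ends x a₂ b)) (decide (Conn ends x a₂ a₃)) (decide (Conn ends x b a₃)) p a).Hb || (modelC (decide (Conn ends x a₁ a₂)) (decide (Conn ends x a₁ b)) (decide (Conn ends x a₁ a₃)) (decide (Conn ends x a₂ b)) (decide (Conn ends x a₂ a₃)) (decide (Conn ends x b a₃)) p a).Ho, (modelC (decide (Conn ends x a₁ a₂)) (decide (Conn ends x a₁ b)) (decide (Conn ends x a₁ a₃)) (decide (Conn ends x a₂ b)) (decide (Conn ends x a₂ a₃)) (decide (Conn ends x b a₃)) p a).L3 || ((modelC (decide (Conn ends x a₁ a₂)) (decide (Conn ends x a₁ b)) (decide (Conn ends x a₁ a₃)) (decide (Conn ends x a₂ b)) (decide (Conn ends x a₂ a₃))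 (decide (Conn ends x b a₃)) p a).Lo && ((decide (Conn ends x b a₃)) || (p && a && ((decide (Conn ends x a₁ b)) || (decide (Conn ends x a₂ b))) && ((decide (Conn ends x a₁ a₃)) || (decide (Conn ends x a₂ a₃)))))) || ((modelC (decide (Conn ends x a₁ a₂)) (decide (Conn ends x a₁ b)) (decide (Conn ends x a₁ a₃)) (decide (Conn ends x a₂ b)) (decide (Conn ends x a₂ a₃)) (decide (Conn ends x b a₃)) p a).Lb && ((p && (modelC (decide (Conn ends x a₁ a₂)) (decide (Conn ends x a₁ b)) (decide (Conn ends x a₁ a₃)) (decide (Conn ends x a₂ b)) (decide (Conn ends x a₂ a₃)) (decide (Conn ends x b a₃)) p a).L3) || (a && (modelC (decide (Conn ends x a₁ a₂)) (decide (Conn ends x a₁ b)) (decide (Conn ends x a₁ a₃)) (decide (Conn ends x a₂ b)) (decide (Conn ends x a₂ a₃)) (decide (Conn ends x b a₃)) p a).H3))), (modelC (decide (Conn ends x a₁ a₂)) (decide (Conn ends x a₁ b)) (decide (Conn ends x a₁ a₃)) (decide (Conn ends x a₂ b)) (decide (Conn ends x a₂ a₃)) (decide (Conn ends x b a₃)) p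 a).H3 || ((modelC (decide (Conn ends x a₁ a₂)) (decide (Conn ends x a₁ b)) (decide (Conn ends x a₁ a₃)) (decide (Conn ends x a₂ b)) (decide (Conn ends x a₂ a₃)) (decide (Conn ends x b a₃)) p a).Ho && ((decide (Conn ends x b a₃)) || (p && a && ((decide (Conn ends x a₁ b)) || (decide (Conn ends x a₂ b))) && ((decide (Conn ends x a₁ a₃)) || (decide (Conn ends x a₂ a₃)))))) || ((modelC (decide (Conn ends x a₁ a₂)) (decide (Conn ends x a₁ b)) (decide (Conn ends x a₁ a₃)) (decide (Conn ends x a₂ b)) (decide (Conn ends x a₂ a₃)) (decide (Conn ends x b a₃)) p a).Hb && ((p && (modelC (decide (Conn ends x a₁ a₂)) (decide (Conn ends x a₁ b)) (decide (Conn ends x a₁ a₃)) (decide (Conn ends x a₂ b)) (decide (Conn ends x a₂ a₃)) (decide (Conn ends x b a₃)) p a).L3) || (a && (modelC (decide (Conn ends x a₁ a₂)) (decide (Conn ends x a₁ b)) (decide (Conn ends x a₁ a₃)) (decide (Conn ends x a₂ b)) (decide (Conn ends x a₂ a₃)) (decide (Conn ends x b a₃)) p a).H3)))) else (modelC (decide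 (Conn ends x a₁ a₂)) (decide (Conn ends x a₁ b)) (decide (Conn ends x a₁ a₃)) (decide (Conn ends x a₂ b)) (decide (Conn ends x a₂ a₃)) (decide (Conn ends x b a₃)) p a)) := by
  have hother' : ∀ e', e' ≠ e → e' ≠ f → o ∈ ends e' → x e' = false := fun e' h1 h2 ho' => by
    by_cases h3 : e' = g
    · rw [h3]; exact hxg
    · exact hother e' h1 h2 h3 ho'
  set x₁ := Function.update (Function.update x e p) f a with hx₁
  have ux : Function.update (Function.update x e false) f false = x := by
    funext e'
    by_cases h1 : e' = f
    · subst h1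
      rw [Function.update_self, hxf]
    · rw [Function.update_of_ne h1]
      by_cases h2 : e' = e
      · subst h2
        rw [Function.update_self, hxe]
      · rw [Function.update_of_ne h2]
  have hC : st ends o a₁ a₂ a₃ b x₁ = modelC (decide (Conn ends x a₁ a₂)) (decide (Conn ends x a₁ b))
      (decide (Conn ends x a₁ a₃)) (decide (Conn ends x a₂ b)) (decide (Conn ends x a₂ a₃))
      (decide (Conn ends x b a₃)) p a := by
    have h := st_modelC ends o a₁ a₂ a₃ b hef he hf ho1 ho2 ho3 hob x hother' p a
    rw [ux] at h
    exact h
  set mc := modelC (decide (Conn ends x a₁ a₂)) (decide (Conn ends x a₁ b))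
      (decide (Conn ends x a₁ a₃)) (decide (Conn ends x a₂ b)) (decide (Conn ends x a₂ a₃))
      (decide (Conn ends x b a₃)) p a with hmc
  clear_value mc
  have hx₁g : x₁ g = false := by
    rw [hx₁, Function.update_of_ne hfg.symm, Function.update_of_ne heg.symm, hxg]
  cases u
  · have h0 : Function.update x₁ g false = x₁ := by
      rw [show (false : Bool) = x₁ g from hx₁g.symm, Function.update_eq_self]
    simp only [Bool.false_eq_true, if_false]
    rw [h0, hC]
  · simp only [if_true]
    -- the connections in `x₁`, through the coordinates of `modelC`
    have off := fun {s t : V} (hs : s ≠ o) (ht : t ≠ o) =>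
      conn_off_mid hef he hf ho1 ho2 x hother' p a hs ht
    have mid := fun {s : V} (hs : s ≠ o) => conn_mid_iff hef he hf ho1 ho2 x hother' p a hs
    rw [ux] at off
    have cq : Conn ends x₁ a₂ a₁ ↔ mc.q' = true := by
      rw [← hC]; unfold st St.q'; simp only [decide_eq_true_eq]
    have cLo : Conn ends x₁ a₁ o ↔ mc.Lo = true := by
      rw [← hC]; unfold st St.Lo; simp only [decide_eq_true_eq]
    have cHo : Conn ends x₁ a₂ o ↔ mc.Ho = true := by
      rw [← hC]; unfold st St.Ho; simp only [decide_eq_true_eq]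
    have cLb : Conn ends x₁ a₁ b ↔ mc.Lb = true := by
      rw [← hC]; unfold st St.Lb; simp only [decide_eq_true_eq]
    have cHb : Conn ends x₁ a₂ b ↔ mc.Hb = true := by
      rw [← hC]; unfold st St.Hb; simp only [decide_eq_true_eq]
    have cL3 : Conn ends x₁ a₁ a₃ ↔ mc.L3 = true := by
      rw [← hC]; unfold st St.L3; simp only [decide_eq_true_eq]
    have cH3 : Conn ends x₁ a₂ a₃ ↔ mc.H3 = true := by
      rw [← hC]; unfold st St.H3; simp only [decide_eq_true_eq]
    -- the two further connections
    have cB3 : Conn ends x₁ b a₃ ↔ (decide (Conn ends x b a₃) ||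
        (p && a && (decide (Conn ends x a₁ b) || decide (Conn ends x a₂ b)) &&
          (decide (Conn ends x a₁ a₃) || decide (Conn ends x a₂ a₃)))) = true := by
      rw [off hob.symm ho3.symm]
      simp only [Bool.or_eq_true, Bool.and_eq_true, decide_eq_true_eq]
      constructor
      · rintro (h | ⟨hm, h1, h2⟩)
        · exact Or.inl h
        · refine Or.inr ⟨⟨hm, ?_⟩, ?_⟩
          · rcases h1 with h1 | h1
            · exact Or.inl (conn_symm h1)
            · exact Or.inr (conn_symm h1)
          · rcases h2 with h2 | h2
            · exact Or.inl (conn_symm h2)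
            · exact Or.inr (conn_symm h2)
      · rintro (h | ⟨⟨hm, h1⟩, h2⟩)
        · exact Or.inl h
        · refine Or.inr ⟨hm, ?_, ?_⟩
          · rcases h1 with h1 | h1
            · exact Or.inl (conn_symm h1)
            · exact Or.inr (conn_symm h1)
          · rcases h2 with h2 | h2
            · exact Or.inl (conn_symm h2)
            · exact Or.inr (conn_symm h2)
    have cO3 : Conn ends x₁ o a₃ ↔ ((p && mc.L3) || (a && mc.H3)) = true := by
      have h := mid ho3.symm
      simp only [Bool.or_eq_true, Bool.and_eq_true]
      rw [← cL3, ← cH3]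
      constructor
      · intro h'
        rcases h.1 (conn_symm h') with ⟨hp, h1⟩ | ⟨ha, h1⟩
        · exact Or.inl ⟨hp, conn_symm h1⟩
        · exact Or.inr ⟨ha, conn_symm h1⟩
      · rintro (⟨hp, h1⟩ | ⟨ha, h1⟩)
        · exact conn_symm (h.2 (Or.inl ⟨hp, conn_symm h1⟩))
        · exact conn_symm (h.2 (Or.inr ⟨ha, conn_symm h1⟩))
    have cBo : Conn ends x₁ b o ↔ ((p && mc.Lb) || (a && mc.Hb)) = true := by
      have h := mid hob.symm
      simp only [Bool.or_eq_true, Bool.and_eq_true]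
      rw [← cLb, ← cHb]
      constructor
      · intro h'
        rcases h.1 h' with ⟨hp, h1⟩ | ⟨ha, h1⟩
        · exact Or.inl ⟨hp, conn_symm h1⟩
        · exact Or.inr ⟨ha, conn_symm h1⟩
      · rintro (⟨hp, h1⟩ | ⟨ha, h1⟩)
        · exact h.2 (Or.inl ⟨hp, conn_symm h1⟩)
        · exact h.2 (Or.inr ⟨ha, conn_symm h1⟩)
    have upd := fun (s t : V) => OneEdge.conn_update_true_iff hg x₁ s t
    have sym : ∀ s t : V, Conn ends x₁ s t ↔ Conn ends x₁ t s := fun s t => ⟨conn_symm, conn_symm⟩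
    have roo : Conn ends x₁ o o := conn_refl ends x₁ o
    have rbb : Conn ends x₁ b b := conn_refl ends x₁ b
    unfold st
    simp only [Prod.mk.injEq]
    refine ⟨?_, ?_, ?_, ?_, ?_, ?_, ?_⟩
    · apply Bool.eq_iff_iff.mpr
      simp only [decide_eq_true_eq]
      rw [upd, sym b a₁, sym o a₁, cq, cHo, cLb, cHb, cLo]
      simp only [Bool.or_eq_true, Bool.and_eq_true]
      clear hmc hC off mid upd sym cq cLo cHo cLb cHb cL3 cH3 cB3 cO3 cBo hother hother' ux hx₁ hx₁g roo rbb
      tauto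
    · apply Bool.eq_iff_iff.mpr
      simp only [decide_eq_true_eq]
      rw [upd, cLo, cBo, cLb]
      simp only [roo, and_true, Bool.or_eq_true, Bool.and_eq_true]
      clear hmc hC off mid upd sym cq cLo cHo cLb cHb cL3 cH3 cB3 cO3 cBo hother hother' ux hx₁ hx₁g roo rbb
      tauto
    · apply Bool.eq_iff_iff.mpr
      simp only [decide_eq_true_eq]
      rw [upd, cHo, cBo, cHb]
      simp only [roo, and_true, Bool.or_eq_true, Bool.and_eq_true]
      clear hmc hC off mid upd sym cq cLo cHo cLb cHb cL3 cH3 cB3 cO3 cBo hother hother' ux hx₁ hx₁g roo rbb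
      tauto
    · apply Bool.eq_iff_iff.mpr
      simp only [decide_eq_true_eq]
      rw [upd, cLb, cLo, sym o b, cBo]
      simp only [rbb, and_true, Bool.or_eq_true, Bool.and_eq_true]
      clear hmc hC off mid upd sym cq cLo cHo cLb cHb cL3 cH3 cB3 cO3 cBo hother hother' ux hx₁ hx₁g roo rbb
      tauto
    · apply Bool.eq_iff_iff.mpr
      simp only [decide_eq_true_eq]
      rw [upd, cHb, cHo, sym o b, cBo]
      simp only [rbb, and_true, Bool.or_eq_true, Bool.and_eq_true]
      clear hmc hC off mid upd sym cq cLo cHo cLb cHb cL3 cH3 cB3 cO3 cBo hother hother' ux hx₁ hx₁g roo rbb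
      tauto
    · apply Bool.eq_iff_iff.mpr
      simp only [decide_eq_true_eq]
      rw [upd, cL3, cLo, cB3, cLb, cO3]
      simp only [Bool.or_eq_true, Bool.and_eq_true, decide_eq_true_eq]
      exact or_assoc.symm
    · apply Bool.eq_iff_iff.mpr
      simp only [decide_eq_true_eq]
      rw [upd, cH3, cHo, cB3, cHb, cO3]
      simp only [Bool.or_eq_true, Bool.and_eq_true, decide_eq_true_eq]
      clear hmc hC off mid upd sym cq cLo cHo cLb cHb cL3 cH3 cB3 cO3 cBo hother hother' ux hx₁ hx₁g roo rbb
      exact or_assoc.symm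

end StateLemma

end MarkedSeries

end CovForm

end Summit.Ventures.PercRepro2
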